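import Mathlib
import Summits.ValiantsHypothesis.ValiantsHypothesis.Theorems.LacunarySymmetroidMatrixDescartesDefiniteMomentsZonesExactWindow
import Summits.ValiantsHypothesis.ValiantsHypothesis.Theorems.LacunarySymmetroidMatrixDescartesInertiaCertificate

/-!
# `MatrixDescartes` (stmt-ValiantsHypothesis-18050) — INERTIA KIT, V: ALTERNATING DEFINITE SCALES FORCE ROOTS WITH
# MULTIPLICITY — `V + 1` scales at which an arbitrary real-symmetric lacunary pencil is definite with alternating signs
# enclose at least `V · m` roots of `det F` counted with multiplicity (every format, no Rayleigh budget)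

HONEST FRAMING.  Cell `pub-symmetroid`, seat `val-sym-mdr-p2` (gen 16); helper file `--supports` the crux
`Theses.LacunarySymmetroid.MatrixDescartes`, NO closure claim.  A LOWER-bound tool for every symmetric pencil at every format —
the converse companion of gen 14's Theorem C (`card_posRoots_le_of_alternatingMoments`: with the Rayleigh budget, AT MOST `V·m`
DISTINCT positive zeros): WITHOUT any budget, alternating definite scales already force AT LEAST `V·m` roots counted with
multiplicity, `m` in each gap.  Nothing here bears on the crux in its window, on `stub_twoSided`, on `DoorA26`/`DoorA34`,
registers, or `VP ≠ VNP`.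

THEOREM (`card_roots_gap_ge_of_definite_ends`, `card_roots_ge_mul_of_alternatingScales`).  `F(X) = ∑ₖ X^{dₖ}Sₖ` real
symmetric.  If `F(a) ` and `F(b)` (`a ≤ b`) are definite of opposite signs then `det F` has at least `card ι` roots in `(a, b)`
counted with multiplicity (the negative index travels from `0` to `card ι` or back, and moves by at most the multiplicity:
`Inertia.dist_negIndex_le_card_roots_gap`); hence `V + 1` alternating definite scales `a₀ < ⋯ < a_V` enclose at least
`V · card ι` roots with multiplicity in `(a₀, a_V)`. [folklore]; axioms standard; no definitions.
-/

-- layout Summits/ValiantsHypothesis/ValiantsHypothesis forces the duplicated namespace component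
set_option linter.dupNamespace false

namespace Summit.ValiantsHypothesis.ValiantsHypothesis.Theorems.LacunarySymmetroidMatrixDescartes

open Polynomial Matrix Finset
open scoped BigOperators Topology

namespace Inertia

variable {ι : Type} [Fintype ι] [DecidableEq ι] {κ : Type} [Fintype κ]

/-- **Definite ends of opposite signs enclose `card ι` roots with multiplicity.**  `c·F(a) ≻ 0 ≻ c·F(b)` (`a ≤ b`) for an
arbitrary real-symmetric lacunary pencil ⇒ `det F` has at least `card ι` roots in `(a, b)` counted with multiplicity.
[folklore] -/
theorem card_roots_gap_ge_of_definite_ends (d : κ → ℕ) (S : κ → Matrix ι ι ℝ) (hS : ∀ k, (S k).IsSymm) {a b : ℝ}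
    (hab : a ≤ b) (c : ℝ)
    (hFa : ∀ v : ι → ℝ, v ≠ 0 → 0 < c * (v ⬝ᵥ ((∑ k, a ^ d k • S k) *ᵥ v)))
    (hFb : ∀ v : ι → ℝ, v ≠ 0 → c * (v ⬝ᵥ ((∑ k, b ^ d k • S k) *ᵥ v)) < 0) :
    Fintype.card ι ≤ Multiset.card ((Matrix.det (∑ k, ((X : ℝ[X]) ^ d k) • (S k).map C)).roots.filter
      (fun t => a < t ∧ t < b)) := by
  classical
  rcases isEmpty_or_nonempty ι with hι | hι
  · rw [Fintype.card_eq_zero]; exact Nat.zero_le _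
  have hv₀ : (fun _ : ι => (1 : ℝ)) ≠ 0 := fun h => by
    have := congrFun h (Classical.arbitrary ι); simp at this
  have hc0 : c ≠ 0 := by
    intro h; have := hFa _ hv₀; rw [h, zero_mul] at this; exact lt_irrefl 0 this
  have hH := isHermitian_pencil d S hS
  have hdetA : (∑ k, a ^ d k • S k).det ≠ 0 := DefiniteMoments.det_ne_zero_of_form_ne_zero fun v hv h => by
    have := hFa v hv; rw [h, mul_zero] at this; exact lt_irrefl 0 this
  have hdetB : (∑ k, b ^ d k • S k).det ≠ 0 := DefiniteMoments.det_ne_zero_of_form_ne_zero fun v hv h => by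
    have := hFb v hv; rw [h, mul_zero] at this; exact lt_irrefl 0 this
  have hP0 : Matrix.det (∑ k, ((X : ℝ[X]) ^ d k) • (S k).map C) ≠ 0 := fun h => hdetA (by
    have e := DefiniteMoments.eval_det_pencil d S a
    rw [h, eval_zero] at e
    exact e.symm)
  have hdist := dist_negIndex_le_card_roots_gap d S hS hP0 hab hdetA hdetB
  -- the indices at the two definite ends
  rcases lt_or_gt_of_ne hc0 with hc | hc
  · have hFa' : ∀ v : ι → ℝ, v ≠ 0 → v ⬝ᵥ ((∑ k, a ^ d k • S k) *ᵥ v) < 0 :=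
      fun v hv => DefiniteMoments.neg_of_mul_pos_left' hc (hFa v hv)
    have hFb' : ∀ v : ι → ℝ, v ≠ 0 → 0 < v ⬝ᵥ ((∑ k, b ^ d k • S k) *ᵥ v) := fun v hv => by
      rcases mul_neg_iff.1 (hFb v hv) with h | h
      · exact absurd h.1 (not_lt.2 hc.le)
      · exact h.2
    obtain ⟨hνa, -, -⟩ := DefiniteMoments.indices_of_neg (hH a) hFa'
    obtain ⟨hνb, -, -⟩ := DefiniteMoments.indices_of_pos (hH b) hFb'
    rw [hνa, hνb] at hdist
    unfold Nat.dist at hdist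
    omega
  · have hFa' : ∀ v : ι → ℝ, v ≠ 0 → 0 < v ⬝ᵥ ((∑ k, a ^ d k • S k) *ᵥ v) :=
      fun v hv => DefiniteMoments.pos_of_mul_pos_left' hc (hFa v hv)
    have hFb' : ∀ v : ι → ℝ, v ≠ 0 → v ⬝ᵥ ((∑ k, b ^ d k • S k) *ᵥ v) < 0 := fun v hv => by
      rcases mul_neg_iff.1 (hFb v hv) with h | h
      · exact h.2
      · exact absurd h.1 (not_lt.2 hc.le)
    obtain ⟨hνa, -, -⟩ := DefiniteMoments.indices_of_pos (hH a) hFa'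
    obtain ⟨hνb, -, -⟩ := DefiniteMoments.indices_of_neg (hH b) hFb'
    rw [hνa, hνb] at hdist
    unfold Nat.dist at hdist
    omega

/-- **ALTERNATING DEFINITE SCALES FORCE ROOTS.**  If an arbitrary real-symmetric lacunary pencil is definite with alternating
signs at scales `a₀ < a₁ < ⋯ < a_V` (`σ(−1)ʲ·vᵀF(aⱼ)v > 0` for `v ≠ 0`), then `det F` has at least `V · card ι` roots in
`(a₀, a_V)` counted with multiplicity. [folklore] -/
theorem card_roots_ge_mul_of_alternatingScales (d : κ → ℕ) (S : κ → Matrix ι ι ℝ) (hS : ∀ k, (S k).IsSymm) {V : ℕ}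
    (a : Fin (V + 1) → ℝ) (ha : StrictMono a) (σ : ℝ)
    (hdef : ∀ (j : Fin (V + 1)) (v : ι → ℝ), v ≠ 0 →
      0 < σ * (-1) ^ (j : ℕ) * (v ⬝ᵥ ((∑ k, a j ^ d k • S k) *ᵥ v))) :
    V * Fintype.card ι ≤ Multiset.card ((Matrix.det (∑ k, ((X : ℝ[X]) ^ d k) • (S k).map C)).roots.filter
      (fun t => a 0 < t ∧ t < a (Fin.last V))) := by
  classical
  have hgap : ∀ i : Fin V, Fintype.card ι ≤ Multiset.card ((Matrix.det (∑ k, ((X : ℝ[X]) ^ d k) • (S k).map C)).roots.filter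
      (fun t => a i.castSucc < t ∧ t < a i.succ)) := by
    intro i
    refine card_roots_gap_ge_of_definite_ends d S hS (ha (Fin.castSucc_lt_succ)).le (σ * (-1) ^ (i : ℕ)) ?_ ?_
    · intro v hv
      have h := hdef i.castSucc v hv
      rwa [Fin.val_castSucc] at h
    · intro v hv
      have h := hdef i.succ v hv
      rw [Fin.val_succ, pow_succ] at h
      have e : σ * ((-1) ^ (i : ℕ) * -1) * (v ⬝ᵥ ((∑ k, a i.succ ^ d k • S k) *ᵥ v))
          = -(σ * (-1) ^ (i : ℕ) * (v ⬝ᵥ ((∑ k, a i.succ ^ d k • S k) *ᵥ v))) := by ring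
      rw [e] at h
      linarith
  calc V * Fintype.card ι = ∑ _i : Fin V, Fintype.card ι := by
        rw [Finset.sum_const, Finset.card_univ, Fintype.card_fin, smul_eq_mul]
    _ ≤ ∑ i : Fin V, Multiset.card ((Matrix.det (∑ k, ((X : ℝ[X]) ^ d k) • (S k).map C)).roots.filter
          (fun t => a i.castSucc < t ∧ t < a i.succ)) := Finset.sum_le_sum fun i _ => hgap i
    _ ≤ _ := sum_card_filter_gap_le _ a ha

/-- **Positive-roots form**: with `a₀ ≥ 0`, at least `V · card ι` POSITIVE roots with multiplicity. [folklore] -/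
theorem card_posRoots_multiset_ge_mul_of_alternatingScales (d : κ → ℕ) (S : κ → Matrix ι ι ℝ) (hS : ∀ k, (S k).IsSymm)
    {V : ℕ} (a : Fin (V + 1) → ℝ) (ha : StrictMono a) (ha0 : 0 ≤ a 0) (σ : ℝ)
    (hdef : ∀ (j : Fin (V + 1)) (v : ι → ℝ), v ≠ 0 →
      0 < σ * (-1) ^ (j : ℕ) * (v ⬝ᵥ ((∑ k, a j ^ d k • S k) *ᵥ v))) :
    V * Fintype.card ι
      ≤ Multiset.card ((Matrix.det (∑ k, ((X : ℝ[X]) ^ d k) • (S k).map C)).roots.filter (fun t => 0 < t)) := by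
  refine le_trans (card_roots_ge_mul_of_alternatingScales d S hS a ha σ hdef) ?_
  refine Multiset.card_le_card (Multiset.monotone_filter_right _ fun t ht => ?_)
  exact lt_of_le_of_lt ha0 ht.1

end Inertia

end Summit.ValiantsHypothesis.ValiantsHypothesis.Theorems.LacunarySymmetroidMatrixDescartes
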